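import Mathlib
import HarnessLib
import Summits.MatrixMultiplication.MatrixMultiplication.Theorems.OutsiderSandwichToricCeilingPowSubTwoRules

/-!
# OutsiderSandwich — tight-frame toric ceiling `⟨3^N - 2⟩`, part 4/5: the SPREAD local rules
and the SPREAD core
(decomp-mm lens 4, gen 45, kernel K45; THESES-FREE, `ω`-free; helper toward `LaserTangency`,
stmt-32268 — the extremal subrank/packing cells of the literal host `kroneckerPow (cwTensor ℂ 2) N`)

LABEL.  TORIC · uniform in `N` · NEC-side instrument; induction step (part 5 carries the theorem).

WHAT.  The SPREAD pivot type: no doubled pair; at the pivot the omitted letters `ξ` (of `X`),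
`η = ξ + e` (of `Y`), `ζ = ξ + 2e` (of `Z`) are distinct and `x ↦ {η, ζ}`, `y ↦ {ξ, ζ}`,
`z ↦ {ξ, η}`.
* `spMk`, `spRule r`, `spA₁ … spC₃`: the two local rules (`r = false` primary, `r = true`
  alternative) giving, from the six letters `xe xz yx yz zx ze` at a tail coordinate, the tail
  letters of the three auxiliary rows; `sp_spec` (rows tight, the star slot `(A₁, B₃, C₂)` tight,
  the two co-size-2 slots admissible, six flags) and `sp_diff` (the two rules never agree) are
  `decide`d over `Fin 3` under the SPREAD side condition (no doubled pair at the coordinate).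
* `spT p ξ e ρ …`: the three auxiliary triples (rule selector `ρ : Fin m → Bool` per tail
  coordinate) in the slots `(ξ, ζ, η)`, `(η, ξ, ζ)`, `(ζ, η, ξ)` (direction `2e`).
* `spread_core`: with primary direction `e`, slot `ξ` a star and slots `η`, `ζ` co-size-2 tail
  instances (induction hypothesis `ih`), `glue` yields a diagonal-free perfect matching of
  `D_{m+1} ∖ (X, Y, Z)` containing `spT`, whose direction-`2e` triples are exactly `spT`.
All definitions are plain data (letter / word / `Finset`-valued).
-/

set_option linter.dupNamespace false

namespace Summit.MatrixMultiplication.MatrixMultiplication.Theorems.OutsiderSandwichToricCeilingPowSubTwoSpread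

open Finset
open Summit.MatrixMultiplication.MatrixMultiplication.Theorems.OutsiderSandwichToricCeiling (dSlot)
open Summit.MatrixMultiplication.MatrixMultiplication.Theorems.OutsiderSandwichToricCeilingPowFibres
  (Word Tr3 slotB frame)
open Summit.MatrixMultiplication.MatrixMultiplication.Theorems.OutsiderSandwichToricCeilingPowSubTwoGlue
open Summit.MatrixMultiplication.MatrixMultiplication.Theorems.OutsiderSandwichToricCeilingPowSubTwoRules

variable {m : ℕ}

/-- SPREAD LOCAL RULES.  `spMk a₂ b₁ c₃ a₃ b₂ c₁` lists the tails-letters of the three auxiliary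
rows `(A₁, B₁, C₁)`, `(A₂, B₂, C₂)`, `(A₃, B₃, C₃)`; `spRule false` is the primary rule, `spRule true`
the alternative rule used at ONE tail coordinate of the second matching. [new] -/
def spMk (a₂ b₁ c₃ a₃ b₂ c₁ : Fin 3) :
    (Fin 3 × Fin 3 × Fin 3) × (Fin 3 × Fin 3 × Fin 3) × (Fin 3 × Fin 3 × Fin 3) :=
  ((-(b₁ + c₁), b₁, c₁), (a₂, b₂, -(a₂ + b₂)), (a₃, -(a₃ + c₃), c₃))

/-- [new] -/
def spRule (r : Bool) (xe xz yx yz zx ze : Fin 3) :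
    (Fin 3 × Fin 3 × Fin 3) × (Fin 3 × Fin 3 × Fin 3) × (Fin 3 × Fin 3 × Fin 3) :=
  if r then
    (if zx ≠ xz ∧ xe ≠ yx ∧ yz ≠ ze then spMk xz yx ze zx xe yz else spMk ze xz yx yz zx xe)
  else if yx ≠ zx ∧ xz ≠ yz ∧ xe ≠ ze ∧
      (-(yx + zx) ≠ -(xe + ze) ∧ -(xe + ze) ≠ -(xz + yz) ∧ -(yx + zx) ≠ -(xz + yz)) then
    spMk xz yx ze xe yz zx
  else spMk yx ze xz zx xe yz

/-- [new] -/ def spA₁ (r : Bool) (xe xz yx yz zx ze : Fin 3) : Fin 3 := (spRule r xe xz yx yz zx ze).1.1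
/-- [new] -/ def spB₁ (r : Bool) (xe xz yx yz zx ze : Fin 3) : Fin 3 :=
  (spRule r xe xz yx yz zx ze).1.2.1
/-- [new] -/ def spC₁ (r : Bool) (xe xz yx yz zx ze : Fin 3) : Fin 3 :=
  (spRule r xe xz yx yz zx ze).1.2.2
/-- [new] -/ def spA₂ (r : Bool) (xe xz yx yz zx ze : Fin 3) : Fin 3 :=
  (spRule r xe xz yx yz zx ze).2.1.1
/-- [new] -/ def spB₂ (r : Bool) (xe xz yx yz zx ze : Fin 3) : Fin 3 :=
  (spRule r xe xz yx yz zx ze).2.1.2.1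
/-- [new] -/ def spC₂ (r : Bool) (xe xz yx yz zx ze : Fin 3) : Fin 3 :=
  (spRule r xe xz yx yz zx ze).2.1.2.2
/-- [new] -/ def spA₃ (r : Bool) (xe xz yx yz zx ze : Fin 3) : Fin 3 :=
  (spRule r xe xz yx yz zx ze).2.2.1
/-- [new] -/ def spB₃ (r : Bool) (xe xz yx yz zx ze : Fin 3) : Fin 3 :=
  (spRule r xe xz yx yz zx ze).2.2.2.1
/-- [new] -/ def spC₃ (r : Bool) (xe xz yx yz zx ze : Fin 3) : Fin 3 :=
  (spRule r xe xz yx yz zx ze).2.2.2.2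

/-- The SPREAD local constraints (rows tight, the star slot tight, the two co-size-2 slots
admissible, six flags), as a Boolean. [new] -/
def spGood (r : Bool) (xe xz yx yz zx ze : Fin 3) : Bool :=
  decide ((spA₁ r xe xz yx yz zx ze ≠ spB₁ r xe xz yx yz zx ze ∧
      spB₁ r xe xz yx yz zx ze ≠ spC₁ r xe xz yx yz zx ze ∧
      spA₁ r xe xz yx yz zx ze ≠ spC₁ r xe xz yx yz zx ze) ∧
    (spA₂ r xe xz yx yz zx ze ≠ spB₂ r xe xz yx yz zx ze ∧
      spB₂ r xe xz yx yz zx ze ≠ spC₂ r xe xz yx yz zx ze ∧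
      spA₂ r xe xz yx yz zx ze ≠ spC₂ r xe xz yx yz zx ze) ∧
    (spA₃ r xe xz yx yz zx ze ≠ spB₃ r xe xz yx yz zx ze ∧
      spB₃ r xe xz yx yz zx ze ≠ spC₃ r xe xz yx yz zx ze ∧
      spA₃ r xe xz yx yz zx ze ≠ spC₃ r xe xz yx yz zx ze) ∧
    (spA₁ r xe xz yx yz zx ze ≠ spB₃ r xe xz yx yz zx ze ∧
      spB₃ r xe xz yx yz zx ze ≠ spC₂ r xe xz yx yz zx ze ∧
      spA₁ r xe xz yx yz zx ze ≠ spC₂ r xe xz yx yz zx ze) ∧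
    twice xe (spA₂ r xe xz yx yz zx ze) yz (spB₁ r xe xz yx yz zx ze) zx
      (spC₃ r xe xz yx yz zx ze) = true ∧
    twice xz (spA₃ r xe xz yx yz zx ze) yx (spB₂ r xe xz yx yz zx ze) ze
      (spC₁ r xe xz yx yz zx ze) = true ∧
    (spA₂ r xe xz yx yz zx ze ≠ xe ∧ spA₃ r xe xz yx yz zx ze ≠ xz ∧
      spB₁ r xe xz yx yz zx ze ≠ yz ∧ spB₂ r xe xz yx yz zx ze ≠ yx ∧
      spC₃ r xe xz yx yz zx ze ≠ zx ∧ spC₁ r xe xz yx yz zx ze ≠ ze))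

/-- The two SPREAD rules differ somewhere, as a Boolean. [new] -/
def spDiff (xe xz yx yz zx ze : Fin 3) : Bool :=
  decide (¬ (spA₁ false xe xz yx yz zx ze = spA₁ true xe xz yx yz zx ze ∧
    spB₁ false xe xz yx yz zx ze = spB₁ true xe xz yx yz zx ze ∧
    spC₁ false xe xz yx yz zx ze = spC₁ true xe xz yx yz zx ze ∧
    spA₂ false xe xz yx yz zx ze = spA₂ true xe xz yx yz zx ze ∧
    spB₂ false xe xz yx yz zx ze = spB₂ true xe xz yx yz zx ze ∧
    spC₂ false xe xz yx yz zx ze = spC₂ true xe xz yx yz zx ze ∧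
    spA₃ false xe xz yx yz zx ze = spA₃ true xe xz yx yz zx ze ∧
    spB₃ false xe xz yx yz zx ze = spB₃ true xe xz yx yz zx ze ∧
    spC₃ false xe xz yx yz zx ze = spC₃ true xe xz yx yz zx ze))

/-- Both SPREAD rules meet their specification (`spGood`) at every SPREAD letter configuration
(finite check over `Fin 3`). -/
theorem sp_spec_bool : ∀ (r : Bool) (xe xz yx yz zx ze : Fin 3), twice xe xz yx yz zx ze = true →
    xe ≠ xz → yx ≠ yz → zx ≠ ze → spGood r xe xz yx yz zx ze = true := by
  decide

/-- The two SPREAD rules differ (`spDiff`) at every SPREAD letter configuration (finite check). -/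
theorem sp_diff_bool : ∀ xe xz yx yz zx ze : Fin 3, twice xe xz yx yz zx ze = true →
    xe ≠ xz → yx ≠ yz → zx ≠ ze → spDiff xe xz yx yz zx ze = true := by
  decide

/-- THE SPREAD LOCAL LEMMA (both rules). -/
theorem sp_spec (r : Bool) (xe xz yx yz zx ze : Fin 3) (h : twice xe xz yx yz zx ze = true)
    (h₁ : xe ≠ xz) (h₂ : yx ≠ yz) (h₃ : zx ≠ ze) :
    (spA₁ r xe xz yx yz zx ze ≠ spB₁ r xe xz yx yz zx ze ∧
      spB₁ r xe xz yx yz zx ze ≠ spC₁ r xe xz yx yz zx ze ∧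
      spA₁ r xe xz yx yz zx ze ≠ spC₁ r xe xz yx yz zx ze) ∧
    (spA₂ r xe xz yx yz zx ze ≠ spB₂ r xe xz yx yz zx ze ∧
      spB₂ r xe xz yx yz zx ze ≠ spC₂ r xe xz yx yz zx ze ∧
      spA₂ r xe xz yx yz zx ze ≠ spC₂ r xe xz yx yz zx ze) ∧
    (spA₃ r xe xz yx yz zx ze ≠ spB₃ r xe xz yx yz zx ze ∧
      spB₃ r xe xz yx yz zx ze ≠ spC₃ r xe xz yx yz zx ze ∧
      spA₃ r xe xz yx yz zx ze ≠ spC₃ r xe xz yx yz zx ze) ∧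
    (spA₁ r xe xz yx yz zx ze ≠ spB₃ r xe xz yx yz zx ze ∧
      spB₃ r xe xz yx yz zx ze ≠ spC₂ r xe xz yx yz zx ze ∧
      spA₁ r xe xz yx yz zx ze ≠ spC₂ r xe xz yx yz zx ze) ∧
    twice xe (spA₂ r xe xz yx yz zx ze) yz (spB₁ r xe xz yx yz zx ze) zx
      (spC₃ r xe xz yx yz zx ze) = true ∧
    twice xz (spA₃ r xe xz yx yz zx ze) yx (spB₂ r xe xz yx yz zx ze) ze
      (spC₁ r xe xz yx yz zx ze) = true ∧
    (spA₂ r xe xz yx yz zx ze ≠ xe ∧ spA₃ r xe xz yx yz zx ze ≠ xz ∧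
      spB₁ r xe xz yx yz zx ze ≠ yz ∧ spB₂ r xe xz yx yz zx ze ≠ yx ∧
      spC₃ r xe xz yx yz zx ze ≠ zx ∧ spC₁ r xe xz yx yz zx ze ≠ ze) := by
  have h' := sp_spec_bool r xe xz yx yz zx ze h h₁ h₂ h₃
  rwa [spGood, decide_eq_true_iff] at h'

/-- The two SPREAD rules never produce the same three auxiliary rows (Prop form of `sp_diff_bool`). -/
theorem sp_diff (xe xz yx yz zx ze : Fin 3) (h : twice xe xz yx yz zx ze = true)
    (h₁ : xe ≠ xz) (h₂ : yx ≠ yz) (h₃ : zx ≠ ze) :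
    ¬ (spA₁ false xe xz yx yz zx ze = spA₁ true xe xz yx yz zx ze ∧
      spB₁ false xe xz yx yz zx ze = spB₁ true xe xz yx yz zx ze ∧
      spC₁ false xe xz yx yz zx ze = spC₁ true xe xz yx yz zx ze ∧
      spA₂ false xe xz yx yz zx ze = spA₂ true xe xz yx yz zx ze ∧
      spB₂ false xe xz yx yz zx ze = spB₂ true xe xz yx yz zx ze ∧
      spC₂ false xe xz yx yz zx ze = spC₂ true xe xz yx yz zx ze ∧
      spA₃ false xe xz yx yz zx ze = spA₃ true xe xz yx yz zx ze ∧
      spB₃ false xe xz yx yz zx ze = spB₃ true xe xz yx yz zx ze ∧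
      spC₃ false xe xz yx yz zx ze = spC₃ true xe xz yx yz zx ze) := by
  have h' := sp_diff_bool xe xz yx yz zx ze h h₁ h₂ h₃
  rwa [spDiff, decide_eq_true_iff] at h'

/-- Tail word of an auxiliary SPREAD row: the local rule (selector `ρ j`) applied to the letters of
the six missing words at the tail coordinate `j`. [new] -/
def spLet (f : Bool → Fin 3 → Fin 3 → Fin 3 → Fin 3 → Fin 3 → Fin 3 → Fin 3) (p : Fin (m + 1))
    (ρ : Fin m → Bool) (xe xz yx yz zx ze : Word (m + 1)) : Word m :=
  fun j => f (ρ j) (xe (p.succAbove j)) (xz (p.succAbove j)) (yx (p.succAbove j)) (yz (p.succAbove j))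
    (zx (p.succAbove j)) (ze (p.succAbove j))

/-- `spLet` evaluated: the rule letter computed from the six tail letters at coordinate `j`. -/
@[simp] theorem spLet_apply (f : Bool → Fin 3 → Fin 3 → Fin 3 → Fin 3 → Fin 3 → Fin 3 → Fin 3)
    (p : Fin (m + 1)) (ρ : Fin m → Bool) (xe xz yx yz zx ze : Word (m + 1)) (j : Fin m) :
    spLet f p ρ xe xz yx yz zx ze j = f (ρ j) (xe (p.succAbove j)) (xz (p.succAbove j))
      (yx (p.succAbove j)) (yz (p.succAbove j)) (zx (p.succAbove j)) (ze (p.succAbove j)) := rfl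

/-- The three auxiliary triples of the SPREAD slice at pivot `p` (letters `ξ, ξ+e, ξ+2e`, rule
selector `ρ`): `T_ξ ∈ (ξ, ξ+2e, ξ+e)`, `T_η ∈ (ξ+e, ξ, ξ+2e)`, `T_ζ ∈ (ξ+2e, ξ+e, ξ)`. [new] -/
def spT (p : Fin (m + 1)) (ξ e : Fin 3) (ρ : Fin m → Bool) (xe xz yx yz zx ze : Word (m + 1)) :
    Finset (Tr3 (m + 1)) :=
  {(ins p ξ (spLet spA₁ p ρ xe xz yx yz zx ze), ins p (ξ + e + e) (spLet spB₁ p ρ xe xz yx yz zx ze),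
      ins p (ξ + e) (spLet spC₁ p ρ xe xz yx yz zx ze)),
    (ins p (ξ + e) (spLet spA₂ p ρ xe xz yx yz zx ze), ins p ξ (spLet spB₂ p ρ xe xz yx yz zx ze),
      ins p (ξ + e + e) (spLet spC₂ p ρ xe xz yx yz zx ze)),
    (ins p (ξ + e + e) (spLet spA₃ p ρ xe xz yx yz zx ze),
      ins p (ξ + e) (spLet spB₃ p ρ xe xz yx yz zx ze), ins p ξ (spLet spC₃ p ρ xe xz yx yz zx ze))}

/-! ## §6b The SPREAD core -/

/-- SPREAD CORE at pivot `p` with letters `x ↦ {ξ+e, ξ+2e}`, `y ↦ {ξ, ξ+2e}`, `z ↦ {ξ, ξ+e}` and NO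
doubled pair at any coordinate.  Primary direction `e`: slot `ξ` is a star, slots `ξ+e`, `ξ+2e` are
co-size-2 instances (induction), plus the three auxiliary triples `spT` (rule selector `ρ`).  The
auxiliary triples are recovered from the matching as its triples of direction `2e`. -/
theorem spread_core (ih : ∀ x₁ x₂ y₁ y₂ z₁ z₂ : Word m, x₁ ≠ x₂ → y₁ ≠ y₂ → z₁ ≠ z₂ →
      (∀ i, twice (x₁ i) (x₂ i) (y₁ i) (y₂ i) (z₁ i) (z₂ i) = true) →
      ∃ P, isPM P {x₁, x₂} {y₁, y₂} {z₁, z₂} = true)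
    (hm : 1 ≤ m) {p : Fin (m + 1)} {ξ e : Fin 3} (he : e ≠ 0) (ρ : Fin m → Bool)
    {xe xz yx yz zx ze : Word (m + 1)} (hXe : xe p = ξ + e) (hXz : xz p = ξ + e + e)
    (hYx : yx p = ξ) (hYz : yz p = ξ + e + e) (hZx : zx p = ξ) (hZe : ze p = ξ + e)
    (hadm : ∀ i, twice (xe i) (xz i) (yx i) (yz i) (zx i) (ze i) = true)
    (hsp : ∀ i, xe i ≠ xz i ∧ yx i ≠ yz i ∧ zx i ≠ ze i) :
    ∃ P, isPM P {xe, xz} {yx, yz} {zx, ze} = true ∧ spT p ξ e ρ xe xz yx yz zx ze ⊆ P ∧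
      ∀ t ∈ P, t.2.1 p = t.1 p + (e + e) → t ∈ spT p ξ e ρ xe xz yx yz zx ze := by
  obtain ⟨n₁, n₂, n₃⟩ := F3.lift_ne ξ e he
  have h3 : ξ + e + e + e = ξ := F3.add3 ξ e
  have H := fun j => sp_spec (ρ j) (xe (p.succAbove j)) (xz (p.succAbove j)) (yx (p.succAbove j))
    (yz (p.succAbove j)) (zx (p.succAbove j)) (ze (p.succAbove j)) (hadm _) (hsp _).1 (hsp _).2.1
    (hsp _).2.2
  -- the nine tail words
  obtain ⟨A₁, hA₁⟩ : ∃ w : Word m, w = spLet spA₁ p ρ xe xz yx yz zx ze := ⟨_, rfl⟩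
  obtain ⟨B₁, hB₁⟩ : ∃ w : Word m, w = spLet spB₁ p ρ xe xz yx yz zx ze := ⟨_, rfl⟩
  obtain ⟨C₁, hC₁⟩ : ∃ w : Word m, w = spLet spC₁ p ρ xe xz yx yz zx ze := ⟨_, rfl⟩
  obtain ⟨A₂, hA₂⟩ : ∃ w : Word m, w = spLet spA₂ p ρ xe xz yx yz zx ze := ⟨_, rfl⟩
  obtain ⟨B₂, hB₂⟩ : ∃ w : Word m, w = spLet spB₂ p ρ xe xz yx yz zx ze := ⟨_, rfl⟩
  obtain ⟨C₂, hC₂⟩ : ∃ w : Word m, w = spLet spC₂ p ρ xe xz yx yz zx ze := ⟨_, rfl⟩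
  obtain ⟨A₃, hA₃⟩ : ∃ w : Word m, w = spLet spA₃ p ρ xe xz yx yz zx ze := ⟨_, rfl⟩
  obtain ⟨B₃, hB₃⟩ : ∃ w : Word m, w = spLet spB₃ p ρ xe xz yx yz zx ze := ⟨_, rfl⟩
  obtain ⟨C₃, hC₃⟩ : ∃ w : Word m, w = spLet spC₃ p ρ xe xz yx yz zx ze := ⟨_, rfl⟩
  have F1 : ∀ j, A₁ j ≠ B₁ j ∧ B₁ j ≠ C₁ j ∧ A₁ j ≠ C₁ j := fun j => by
    rw [hA₁, hB₁, hC₁]; exact (H j).1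
  have F2 : ∀ j, A₂ j ≠ B₂ j ∧ B₂ j ≠ C₂ j ∧ A₂ j ≠ C₂ j := fun j => by
    rw [hA₂, hB₂, hC₂]; exact (H j).2.1
  have F3r : ∀ j, A₃ j ≠ B₃ j ∧ B₃ j ≠ C₃ j ∧ A₃ j ≠ C₃ j := fun j => by
    rw [hA₃, hB₃, hC₃]; exact (H j).2.2.1
  have Fst : ∀ j, A₁ j ≠ B₃ j ∧ B₃ j ≠ C₂ j ∧ A₁ j ≠ C₂ j := fun j => by
    rw [hA₁, hB₃, hC₂]; exact (H j).2.2.2.1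
  have Fη : ∀ j, twice (tl p xe j) (A₂ j) (tl p yz j) (B₁ j) (tl p zx j) (C₃ j) = true :=
    fun j => by rw [hA₂, hB₁, hC₃]; exact (H j).2.2.2.2.1
  have Fζ : ∀ j, twice (tl p xz j) (A₃ j) (tl p yx j) (B₂ j) (tl p ze j) (C₁ j) = true :=
    fun j => by rw [hA₃, hB₂, hC₁]; exact (H j).2.2.2.2.2.1
  have G1 : tl p xe ≠ A₂ := fun eq => (H ⟨0, hm⟩).2.2.2.2.2.2.1 (by
    have h := congrFun eq ⟨0, hm⟩; rw [hA₂] at h; exact h.symm)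
  have G2 : tl p xz ≠ A₃ := fun eq => (H ⟨0, hm⟩).2.2.2.2.2.2.2.1 (by
    have h := congrFun eq ⟨0, hm⟩; rw [hA₃] at h; exact h.symm)
  have G3 : tl p yz ≠ B₁ := fun eq => (H ⟨0, hm⟩).2.2.2.2.2.2.2.2.1 (by
    have h := congrFun eq ⟨0, hm⟩; rw [hB₁] at h; exact h.symm)
  have G4 : tl p yx ≠ B₂ := fun eq => (H ⟨0, hm⟩).2.2.2.2.2.2.2.2.2.1 (by
    have h := congrFun eq ⟨0, hm⟩; rw [hB₂] at h; exact h.symm)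
  have G5 : tl p zx ≠ C₃ := fun eq => (H ⟨0, hm⟩).2.2.2.2.2.2.2.2.2.2.1 (by
    have h := congrFun eq ⟨0, hm⟩; rw [hC₃] at h; exact h.symm)
  have G6 : tl p ze ≠ C₁ := fun eq => (H ⟨0, hm⟩).2.2.2.2.2.2.2.2.2.2.2 (by
    have h := congrFun eq ⟨0, hm⟩; rw [hC₁] at h; exact h.symm)
  -- the three sub-matchings
  have hQξ := isPM_star A₁ B₃ C₂ Fst
  obtain ⟨Qη, hQη⟩ := ih (tl p xe) A₂ (tl p yz) B₁ (tl p zx) C₃ G1 G3 G5 Fη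
  obtain ⟨Qζ, hQζ⟩ := ih (tl p xz) A₃ (tl p yx) B₂ (tl p ze) C₁ G2 G4 G6 Fζ
  -- the auxiliary triples
  obtain ⟨T₁, hT₁⟩ : ∃ T : Tr3 (m + 1), T = (ins p ξ A₁, ins p (ξ + e + e) B₁, ins p (ξ + e) C₁) :=
    ⟨_, rfl⟩
  obtain ⟨T₂, hT₂⟩ : ∃ T : Tr3 (m + 1), T = (ins p (ξ + e) A₂, ins p ξ B₂, ins p (ξ + e + e) C₂) :=
    ⟨_, rfl⟩
  obtain ⟨T₃, hT₃⟩ : ∃ T : Tr3 (m + 1), T = (ins p (ξ + e + e) A₃, ins p (ξ + e) B₃, ins p ξ C₃) :=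
    ⟨_, rfl⟩
  have hAux : spT p ξ e ρ xe xz yx yz zx ze = {T₁, T₂, T₃} := by
    rw [hT₁, hT₂, hT₃, hA₁, hB₁, hC₁, hA₂, hB₂, hC₂, hA₃, hB₃, hC₃]; rfl
  rw [hAux]
  refine ⟨glue p e {T₁, T₂, T₃} fun a' => if a' = ξ then (univ.erase A₁).image (tr (B₃ - A₁)) else
      if a' = ξ + e then Qη else Qζ, ?_, fun t ht => mem_glue.2 (Or.inl ht), ?_⟩
  · refine isPM_glue he ?_ ?_ ?_ ?_ ?_ ?_ ?_ ?_
    · intro t ht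
      simp only [mem_insert, mem_singleton] at ht
      rcases ht with rfl | rfl | rfl
      · rw [hT₁]; exact mk3_mem_tfr.2 ⟨⟨n₃, n₂.symm, n₁⟩, F1⟩
      · rw [hT₂]; exact mk3_mem_tfr.2 ⟨⟨n₁.symm, n₃, n₂⟩, F2⟩
      · rw [hT₃]; exact mk3_mem_tfr.2 ⟨⟨n₂.symm, n₁.symm, n₃.symm⟩, F3r⟩
    · refine injOn_triple ?_ ?_ ?_ <;> simp [hT₁, hT₂, hT₃, n₁, n₂, n₃,
        ]
    · refine injOn_triple ?_ ?_ ?_ <;> simp [hT₁, hT₂, hT₃, n₁, n₂.symm,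
        n₃.symm]
    · refine injOn_triple ?_ ?_ ?_ <;> simp [hT₁, hT₂, hT₃, n₂, n₁.symm,
        n₃.symm]
    · intro t ht
      simp only [mem_insert, mem_singleton] at ht
      rcases ht with rfl | rfl | rfl
      · rw [hT₁]; simp [ins_eq_iff, hXe, hXz, n₁, n₃]
      · rw [hT₂]; simp [ins_eq_iff, hXe, hXz, G1.symm, n₂]
      · rw [hT₃]; simp [ins_eq_iff, hXe, hXz, G2.symm, n₂.symm]
    · intro t ht
      simp only [mem_insert, mem_singleton] at ht
      rcases ht with rfl | rfl | rfl
      · rw [hT₁]; simp [ins_eq_iff, hYx, hYz, G3.symm, n₃.symm]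
      · rw [hT₂]; simp [ins_eq_iff, hYx, hYz, G4.symm, n₃]
      · rw [hT₃]; simp [ins_eq_iff, hYx, hYz, n₂, n₁.symm]
    · intro t ht
      simp only [mem_insert, mem_singleton] at ht
      rcases ht with rfl | rfl | rfl
      · rw [hT₁]; simp [ins_eq_iff, hZx, hZe, G6.symm, n₁.symm]
      · rw [hT₂]; simp [ins_eq_iff, hZx, hZe, n₂.symm, n₃.symm]
      · rw [hT₃]; simp [ins_eq_iff, hZx, hZe, G5.symm, n₁]
    · intro a'
      rcases F3.cases3 ξ e a' he with rfl | rfl | rfl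
      · have e1 : layer p a' ({xe, xz} ∪ ({T₁, T₂, T₃} : Finset (Tr3 (m + 1))).image
            (fun t => t.1)) = {A₁} := by
          ext u; simp [hT₁, hT₂, hT₃, ins_eq_iff, hXe, hXz, n₁, n₃,
            ]
        have e2 : layer p (a' + e) ({yx, yz} ∪ ({T₁, T₂, T₃} : Finset (Tr3 (m + 1))).image
            (fun t => t.2.1)) = {B₃} := by
          ext u; simp [hT₁, hT₂, hT₃, ins_eq_iff, hYx, hYz, n₂, n₁.symm,
            ]
        have e3 : layer p (a' + e + e) ({zx, ze} ∪ ({T₁, T₂, T₃} : Finset (Tr3 (m + 1))).image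
            (fun t => t.2.2)) = {C₂} := by
          ext u; simp [hT₁, hT₂, hT₃, ins_eq_iff, hZx, hZe, n₂.symm,
            n₃.symm]
        rw [e1, e2, e3, if_pos rfl]
        exact hQξ
      · have e1 : layer p (ξ + e) ({xe, xz} ∪ ({T₁, T₂, T₃} : Finset (Tr3 (m + 1))).image
            (fun t => t.1)) = {tl p xe, A₂} := by
          ext u; simp [hT₁, hT₂, hT₃, ins_eq_iff, hXe, hXz, n₂, n₁.symm,
            ]; exact or_comm
        have e2 : layer p (ξ + e + e) ({yx, yz} ∪ ({T₁, T₂, T₃} : Finset (Tr3 (m + 1))).image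
            (fun t => t.2.1)) = {tl p yz, B₁} := by
          ext u; simp [hT₁, hT₂, hT₃, ins_eq_iff, hYx, hYz, n₂.symm,
            n₃.symm]; exact or_comm
        have e3 : layer p (ξ + e + e + e) ({zx, ze} ∪ ({T₁, T₂, T₃} : Finset (Tr3 (m + 1))).image
            (fun t => t.2.2)) = {tl p zx, C₃} := by
          ext u; simp [hT₁, hT₂, hT₃, ins_eq_iff, hZx, hZe, h3, n₁, n₃,
            ]
        rw [e1, e2, e3, if_neg n₁.symm, if_pos rfl]
        exact hQη
      · have e1 : layer p (ξ + e + e) ({xe, xz} ∪ ({T₁, T₂, T₃} : Finset (Tr3 (m + 1))).image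
            (fun t => t.1)) = {tl p xz, A₃} := by
          ext u; simp [hT₁, hT₂, hT₃, ins_eq_iff, hXe, hXz, n₂.symm,
            n₃.symm]
        have e2 : layer p (ξ + e + e + e) ({yx, yz} ∪ ({T₁, T₂, T₃} : Finset (Tr3 (m + 1))).image
            (fun t => t.2.1)) = {tl p yx, B₂} := by
          ext u; simp [hT₁, hT₂, hT₃, ins_eq_iff, hYx, hYz, h3, n₁, n₃,
            ]; exact or_comm
        have e3 : layer p (ξ + e + e + e + e) ({zx, ze} ∪ ({T₁, T₂, T₃} : Finset (Tr3 (m + 1))).image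
            (fun t => t.2.2)) = {tl p ze, C₁} := by
          ext u; simp [hT₁, hT₂, hT₃, ins_eq_iff, hZx, hZe, h3, n₂, n₁.symm,
            ]; exact or_comm
        rw [e1, e2, e3, if_neg n₃.symm, if_neg n₂.symm]
        exact hQζ
  · intro t ht h2
    by_contra hA
    rw [glue_dir ht hA] at h2
    exact F3.dir_ne _ _ he h2

end Summit.MatrixMultiplication.MatrixMultiplication.Theorems.OutsiderSandwichToricCeilingPowSubTwoSpread
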